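/- Copyright: the b2b-balaban cell (near-miss cell 7), T⁴-continuum fan-out, lineage t4-ne7b-formalise-leaf-06 (NE7b CRUX
TEAM (2) leaf prover 06), gen 35: IR-50-1 «THE SHRUNK VOLUME DISPLAYS» (supply module); gen 37: v2.2 DOCFIX of the CENSUS NOTE only (VOLUME-3 certified,
balaban-calc P-calc-g23-2, status at d = 4 per OWNER R-OWNER-52-1 (3)∕(4)), code byte-identical to v2.1.  Released under the licence of the surrounding project. -/
import Summits.QuantumFields.BalabanUV.T4Continuum.Support.HistoryBankingVolumeWindowLattice

/-!
# History banking, M5-2d supplier: THE SHRUNK-LEDGER VOLUME DISPLAYS `VolumeDisplaysS` (the OWNER's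
`HistoryBankingShrunkLedger.shrunk_volume_le_lifeCost` volume binders VERBATIM) + the slack filler `huθS` at a displayed class-linear
weight `a` (of record `a := cvol d j Γ`), DISCHARGED AT BOTH LETTERS — per cube (`uvol`, `Γ := 1 + β₀`) and in lattice units (`uvolL`,
`Γ := (1+β₀)·L^d`) — on ONE window ∕ ONE threshold each (route R-P1 of row NE7b; INTERFACE REQUEST IR-50-1 of WORD W-ne7bp1-g50-2 (c); supply module only)

Summits-side support leaf of the T⁴-continuum cell (rung (B)+1 on a FINITE torus only; NOT infinite volume, NOT the mass gap,
NOT the Clay statement; NOT a proof of the spine estimate NE7b — the cell's OWN estimate, NOT PRINTED, NOT PROVED).  [folklore]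
real arithmetic over the siblings `HistoryBankingVolumeWindow` (`uvol`, `jvol`, `hsmall_jvol`, `uvol_later_le`, `letter_mul_le_of_clause`,
`ell_pow_mul_le`), `HistoryBankingVolumeWindowLattice` (`uvolL`, `uvolL_le_of_le`, the window-free steps `uvolL_mul_le_of_clause`,
`coef_mul_letterL_le_credit`), `HistoryBankingRoundingWindow.envelope_of_isRj`, `HistoryBankingRoundingSupply` (`le_pow_of_rpow_inv_le`,
`le_ell_of_coupling`) and the typed flow displays (2.5) `B14.IsRj`, (2.7) `B14.FlowIneq27`, (2.9) `B14FlowStep.FlowIneq29`; no `[cite:]` tag,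
nothing printed asserted, no `def … : Prop`, zero `sorry`.  The OWNER's `HistoryBankingShrunkLedger` is NOT imported: the slack weight is
a PARAMETER `a` (instantiated `a := cvol d j Γ` by the consumer), so this supplier and the ledger land independently.

WHY.  M5-2d (OWNER g50, R-OWNER-49-2 (3)) re-books M5-1b's per-step volume inequality with the lag multiplicity OFF the floors: its
volume hypotheses are `hu`, ONE cumulative growth letter `hΓ : u n ≤ Γ·u t` (`t ≤ n`), a lag `j ≥ 1` with `1122^d·16·21^d·Γ ≤ 2^j∕2`, the
LAG-FREE floor exchange `huS : u t·(6·1122^d) ≤ floorK C K R t`, `huE₂`, `huE₃`, and — in the M5-2c plug twin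
`HistoryBankingShrunkWitness.credit_mul_volume_le_shapeTH_shrunk` — the slack display at the class-linear weight
`cvol d j Γ = 2^{d+3} + 2·1122^d·j·Γ² + 2·561^d·j·Γ`.  THIS FILE bundles those binders (`VolumeDisplaysS`) and discharges them + `huθS`
(at any weight `a ≥ 0`) at print's two letters from the flow rows, exactly as IR-48-2 ∕ IR-49-2 do for M5-2c: per cube the floor gap is
`r·q′ − 1`, in lattice units `r(q′−d) − 1`; the growth letter is `1 + β₀` ((2.7)) resp. `(1+β₀)·L^d` ((2.7) + (2.9)); the lag is `jvol d Γ`.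

WHAT.  §1 **`structure VolumeDisplaysS C d K R u Γ j`** (DISPLAY SHAPE, the OWNER's eight binders verbatim).  §2 per cube:
**`structure VolumeWindowS C d K r κ₂ κᵥ cΛ θᵥ a g`** ((WS1) `6·1122^d·cΛ ≤ E₂·ℓ^{κ₂}`, (WS2)∕(WS3) = (WV2)∕(WV3), (WS4) `a·cΛ ≤ θᵥ·A₀²·ℓ^{κᵥ}`;
`1 + κ₂ = r·q′`, `1 + κᵥ = 2p₀`), window-free steps `uvol_mul_le_of_clause`, `coef_mul_letter_le_credit`, `uvol_le_of_le`;
**`volumeDisplaysS_uvol : VolumeDisplaysS C d K R (uvol cΛ g K) (1+β₀) (jvol d (1+β₀))`**, `_of_isRj`, **`huθS_uvol`** (`a·uvol … n ≤ θᵥ·p₀(g_n)²`),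
record-facing **`volumeDisplaysS_of_log_eq`**, **`huθS_events_of_log_eq`** (the OWNER's `huθS` shape
`∀ e ∈ E, (sh e).kind = 0 → (sh e).step ≤ K → a * u (sh e).step ≤ θᵥ * p0Profile C.A₀ C.p₀ (g (sh e).step) ^ 2`), threshold **`ellVolS`**,
`volumeWindowS_of_threshold` ∕ `_of_couplings`, `exp_neg_ellVolS_pos`, prefix fillers **`volumeDisplaysS_of_log_eq_of_inInterval`**,
**`huθS_events_of_log_eq_of_inInterval`**.  §3 lattice units: **`structure VolumeWindowSL C d K r κ₂ κᵥ cΛ M L θᵥ a g`** ((WS1ᴸ)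
`6·1122^d·(cΛM^d) ≤ E₂·ℓ^{κ₂}`, (WS4ᴸ) `a·(cΛ(LM)^d) ≤ θᵥ·A₀²·ℓ^{κᵥ}`; `1 + κ₂ = r·(q′ − d)`, `d ≤ q′`, `1 + r·d + κᵥ = 2p₀`),
**`volumeDisplaysSL_uvolL : VolumeDisplaysS C d K R (uvolL cΛ M d g R K) ((1+β₀)·L^d) (jvol d ((1+β₀)·L^d))`**, `_of_isRj`, **`huθSL_uvolL`**,
**`volumeDisplaysSL_of_log_eq`**, **`huθSL_events_of_log_eq`**, **`ellVolSL`**, `volumeWindowSL_of_threshold` ∕ `_of_couplings`,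
`exp_neg_ellVolSL_pos`, **`volumeDisplaysSL_of_log_eq_of_inInterval`**, **`huθSL_events_of_log_eq_of_inInterval`**.

CENSUS NOTE (the OWNER's RULING R-OWNER-50-2 «two census readings, VOLUME-3 decides»; desk floats CERTIFIED — balaban-calc GRAMMAR G39 «VOLUME-3»
CLOSED (i)–(v), calc-ref §41; constants SYMBOLIC here, trigger c2∕c6).  THE (WS1)∕(WS1ᴸ) CLAUSE IS WHERE THE RESIDUAL CONSTANT SITS: `6·1122^d` = 2 (absorbed
feedback) × 3 (calibration) × `561^d·2^d` (the MODEL's dead-orbit box and footprint anchors, A1) where print's collar is a `64MR`-cube ([B16] p. 384, locator).  Reading (A),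
print-normalised `E₂ = c_{E₂}M^d64^d`: the lattice (WS1ᴸ) threshold is `ℓ ≥ (6·1122^d∕64^d)·(cΛ∕c_{E₂}) = 5.668·10⁵·(cΛ∕c_{E₂})` — 5.22 orders
below M5-2a's `9.510·10¹⁰·(1+β₀)·(cΛ∕c_{E₂})` (IR-49-2's (WV1ᴸ)), still above `ℓ_w‴(1) = 436` at ratio one; census-NIL iff `cΛ∕c_{E₂} < 7.69·10⁻⁴`
(ℓ = 436) … `9.97·10⁻⁴` (ℓ = 565).  Reading (B′), model-normalised `E₂ := c_{E₂}M^d·6·1122^d`: (WS1ᴸ) reads `cΛ∕c_{E₂} ≤ ℓ` — gap-1 census-NIL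
at every `O(1)` ratio — and `log₁₀(6·1122^d∕64^d) = 5.75` orders move to the clauses where `E₂` is charged against credits (the refuter's
F-item).  Per cube, (WS1) binds at `(6·1122^d·cΛ∕E₂)^{1∕9}`, inside the banking window under either reading.  The slack clause (WS4)∕(WS4ᴸ) at
`a := cvol` is harmless: R-OWNER-50-2 (1)'s «≈ 10²³» (v2.1's «room ≈ 10²³») is the COEFFICIENT class `cvolᴸ(β₀) = 2.02 … 2.32·10²³`; the ROOM is
`ℓ_w‴(1)³⁷∕(cvolᴸ·13⁸) ≥ 10^{65.39}`, no new window class (balaban-calc G39.2, PRECISION P-calc-g23-2; refuter PRICING-NE7b v21 S-v21-2 — corrected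
here).  STATUS AT `d = 4` (OWNER t4-ne7b-p1 g52, R-OWNER-52-1 (3)∕(4); refuter v22 S-v22-1): this M5-2d instance STAYS as a record and is SUPERSEDED
(under `Γ ≥ 1`) by the OWNER's M5-2e per-level dead box `HistoryBankingShrunkLedger82` (collar `6·collar82 d`; reading (A) `361.46·ρ`, NIL at ratio one,
thin), supplier `HistoryBankingVolumeWindowShrunk82` (IR-51-1), whose road to the (α) record is the custodian's IR-51-2 (`toLP82`); no M5-2d embedding is
filed (`B16HistoryWeightPlugW.plug_of_shrunk` certifies the plug at `cvol`); `VolumeDisplaysS` is recovered as the instance `(σ, c) := (6·1122^d,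
1122^d·16·21^d)` of `HistoryBankingVolumeWindowCollar.VolumeDisplaysP` (`volumeDisplaysP_iff_S`); the census sentences of this note describe THIS FILE's
WINDOW LEMMAS (how small the implicit `γ₀` of `ForSmallCouplings` is), never a terminal statement — the `…_fsc` theorems of record are window-blind.

HONEST SCOPE.  Real arithmetic over OUR carriers; both windows are HYPOTHESIS shapes (smallness of OUR letters, reducible to
`g_j ≤ γ ≤ e^{−ℓ∕2}`); `cΛ`, `M`, `a` displayed nonnegative reals, never numerals; nothing of H3 ∕ (B) ∕ BetaPertH is discharged; the
currency readings are the OWNER's rulings, not kernel facts.  Nothing of Bałaban's is asserted or contested.  NE7b NOT PRINTED ∕ NOT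
PROVED; spine 0∕9; rung (B)+1 on a FINITE torus — NOT infinite volume, NOT the mass gap, NOT Clay.  HONEST DEPENDENCY (cell): continuum YM
on T⁴ ⇐ BetaPertH ∧ nine spine estimates (0/9 proved); BetaPertH ⇐ (D1) ∧ (D4) ∧ CAP+tail; G-an2-4 gates asym, D1 and NE2/3/4.  This
file changes none of it.
-/

open Finset
open Literature.MathematicalPhysics.QuantumFieldTheory.Balaban1983to89
open T4PersistenceDictionary T4PrintedShapeBanking T4Continuum
open Summit.QuantumFields.BalabanUV.T4Continuum.HistoryConstants
open Summit.QuantumFields.BalabanUV.T4Continuum.HistoryBankingSharpShares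
open Summit.QuantumFields.BalabanUV.T4Continuum.HistoryBankingRoundingWindow (envelope_of_isRj)
open Summit.QuantumFields.BalabanUV.T4Continuum.HistoryBankingRoundingSupply
open Summit.QuantumFields.BalabanUV.T4Continuum.HistoryBankingVolumeWindow
open Summit.QuantumFields.BalabanUV.T4Continuum.HistoryBankingVolumeWindowLattice

namespace Summit.QuantumFields.BalabanUV.T4Continuum.HistoryBankingVolumeWindowShrunk

noncomputable section

/-! ## §1 The OWNER's shrunk-ledger volume binders, bundled -/
section Bundle

/-- **M5-2d's VOLUME BINDERS, BUNDLED** (DISPLAY SHAPE): the eight hypotheses `hu ∕ hΓ0 ∕ hΓ ∕ hj1 ∕ hsmall ∕ huS ∕ huE₂ ∕ huE₃` of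
`HistoryBankingShrunkLedger.shrunk_volume_le_lifeCost` VERBATIM (weight `u`, ONE cumulative growth letter `Γ`, lag `j`). [folklore] -/
structure VolumeDisplaysS (C : T4PrintedShapeBanking.Consts) (d K : ℕ) (R : ℕ → ℕ) (u : ℕ → ℝ) (Γ : ℝ) (j : ℕ) : Prop where
  /-- the weight is nonnegative -/
  hu : ∀ n, 0 ≤ u n
  /-- the growth letter is nonnegative -/
  hΓ0 : 0 ≤ Γ
  /-- ONE cumulative growth letter -/
  hΓ : ∀ t n, t ≤ n → u n ≤ Γ * u t
  /-- the lag is at least one -/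
  hj1 : 1 ≤ j
  /-- the lag absorbs the feedback -/
  hsmall : (1122 : ℝ) ^ d * 16 * 21 ^ d * Γ ≤ 2 ^ j / 2
  /-- the LAG-FREE floor exchange -/
  huS : ∀ t, t ≤ K → u t * (6 * 1122 ^ d) ≤ floorK C K R t
  /-- the young-birth charge -/
  huE₂ : ∀ n, n ≤ K → u n * (15 * 126 ^ d) ≤ C.E₂ * (R n : ℝ) ^ C.q'
  /-- the size charge -/
  huE₃ : ∀ n, n ≤ K → u n * (24 * 126 ^ d) ≤ C.E₃ * (R n : ℝ) ^ C.q'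

end Bundle

/-! ## §2 Per cube: `u := uvol cΛ g K`, `Γ := 1 + β₀`, `j := jvol d (1 + β₀)` -/
section PerCube

/-- **THE SHRUNK WINDOW, PER CUBE** (HYPOTHESIS SHAPE; gaps `1 + κ₂ = r·q′`, `1 + κᵥ = 2p₀`; floor-type clauses at the letter `cΛ`, the
slack clause at a displayed WEIGHT `a` — of record `a := cvol d j Γ` of the OWNER's `HistoryBankingShrunkLedger`, read at `Γ := 1 + β₀`,
`j := jvol d (1+β₀)`; any other class-linear weight of a later ledger instantiates the same fields). [folklore] -/
structure VolumeWindowS (C : T4PrintedShapeBanking.Consts) (d K r κ₂ κᵥ : ℕ) (cΛ θv a : ℝ) (g : ℕ → ℝ) : Prop where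
  /-- `1 + κ₂ = r·q′` -/
  expF : 1 + κ₂ = r * C.q'
  /-- `1 + κᵥ = 2p₀` -/
  expV : 1 + κᵥ = 2 * C.p₀
  /-- `ℓ ≥ 1` on the performed range -/
  one_le_ell : ∀ n, n ≤ K → 1 ≤ ell g n
  /-- (WS1) -/
  wS : ∀ n, n ≤ K → 6 * 1122 ^ d * cΛ ≤ C.E₂ * ell g n ^ κ₂
  /-- (WS2) -/
  wE₂ : ∀ n, n ≤ K → 15 * 126 ^ d * cΛ ≤ C.E₂ * ell g n ^ κ₂
  /-- (WS3) -/
  wE₃ : ∀ n, n ≤ K → 24 * 126 ^ d * cΛ ≤ C.E₃ * ell g n ^ κ₂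
  /-- (WS4), at the weight `a` -/
  wV : ∀ n, n ≤ K → a * cΛ ≤ θv * C.A₀ ^ 2 * ell g n ^ κᵥ

variable {C : T4PrintedShapeBanking.Consts} {d K r κ₂ κᵥ p L : ℕ} {cΛ θv a β' β₀ γ : ℝ} {g : ℕ → ℝ} {R : ℕ → ℕ}

/-- window-free floor step per cube: `a·cΛ ≤ E·ℓ_n^{κ}`, `1 + κ = r·q′`, `E ≥ 0`, `ℓ_n ≥ 0`, `ℓ_n^{r} ≤ R_n`, `n ≤ K` ⇒
`uvol … n·a ≤ E·R_n^{q′}`. [folklore] -/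
theorem uvol_mul_le_of_clause {κ : ℕ} (hexp : 1 + κ = r * C.q') {a E : ℝ} (hE : 0 ≤ E) {n : ℕ} (hn : n ≤ K) (hℓ : 0 ≤ ell g n)
    (hlow : ell g n ^ r ≤ (R n : ℝ)) (h : a * cΛ ≤ E * ell g n ^ κ) : uvol cΛ g K n * a ≤ E * (R n : ℝ) ^ C.q' := by
  rw [uvol_of_le cΛ g hn]
  exact (letter_mul_le_of_clause hexp hℓ h).trans (mul_le_mul_of_nonneg_left (ell_pow_mul_le hℓ hlow _) hE)

/-- window-free credit step per cube (any weight `a`): `a·cΛ ≤ θ·A₀²·ℓ_n^{κ}`, `1 + κ = 2p₀`, `ℓ_n ≥ 0` ⇒ `a·(cΛ·ℓ_n) ≤ θ·p₀(g_n)²`. [folklore] -/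
theorem coef_mul_letter_le_credit {κ : ℕ} (hexpV : 1 + κ = 2 * C.p₀) {a : ℝ} {n : ℕ} (hℓ : 0 ≤ ell g n)
    (h : a * cΛ ≤ θv * C.A₀ ^ 2 * ell g n ^ κ) : a * (cΛ * ell g n) ≤ θv * p0Profile C.A₀ C.p₀ (g n) ^ 2 := by
  rw [p0Profile_eq]
  calc a * (cΛ * ell g n) = cΛ * ell g n * a := by ring
    _ ≤ θv * C.A₀ ^ 2 * ell g n ^ (2 * C.p₀) := letter_mul_le_of_clause (E := θv * C.A₀ ^ 2) hexpV hℓ h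
    _ = θv * (C.A₀ * ell g n ^ C.p₀) ^ 2 := by rw [mul_pow, ← pow_mul, mul_comm C.p₀ 2]; ring

/-- the per-cube letter in M5-2d's cumulative shape: `uvol … n ≤ (1+β₀)·uvol … t` for `t ≤ n`. [folklore] -/
theorem uvol_le_of_le (hmono : ∀ m n, m < n → n ≤ K → ell g n ≤ (1 + β₀) * ell g m) (hβ₀ : 0 ≤ β₀) (hc : 0 ≤ cΛ)
    (hℓ : ∀ j, j ≤ K → 1 ≤ ell g j) {t n : ℕ} (htn : t ≤ n) : uvol cΛ g K n ≤ (1 + β₀) * uvol cΛ g K t := by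
  obtain ⟨i, rfl⟩ := Nat.exists_eq_add_of_le htn; exact uvol_later_le hmono hβ₀ hc hℓ t i

/-- **`huθS` PER CUBE** at the window's weight: `a·uvol … n ≤ θᵥ·p₀(g_n)²` for `n ≤ K` (`a := cvol d j Γ` of record). [folklore] -/
theorem huθS_uvol (hW : VolumeWindowS C d K r κ₂ κᵥ cΛ θv a g) (n : ℕ) (hn : n ≤ K) :
    a * uvol cΛ g K n ≤ θv * p0Profile C.A₀ C.p₀ (g n) ^ 2 := by
  rw [uvol_of_le cΛ g hn]; exact coef_mul_letter_le_credit hW.expV (zero_le_one.trans (hW.one_le_ell n hn)) (hW.wV n hn)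

/-- **M5-2d's BINDERS DISCHARGED PER CUBE**: (2.7)'s consequence, `β₀, cΛ ≥ 0`, `E₂, E₃ ≥ 0`, the lower (2.5) member and the window
(any weight `a`) give `VolumeDisplaysS C d K R (uvol cΛ g K) (1+β₀) (jvol d (1+β₀))`. [folklore] -/
theorem volumeDisplaysS_uvol (hmono : ∀ m n, m < n → n ≤ K → ell g n ≤ (1 + β₀) * ell g m) (hβ₀ : 0 ≤ β₀) (hc : 0 ≤ cΛ)
    (hE₂ : 0 ≤ C.E₂) (hE₃ : 0 ≤ C.E₃) (hlow : ∀ t, t ≤ K → ell g t ^ r ≤ (R t : ℝ))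
    (hW : VolumeWindowS C d K r κ₂ κᵥ cΛ θv a g) :
    VolumeDisplaysS C d K R (uvol cΛ g K) (1 + β₀) (jvol d (1 + β₀)) where
  hu := uvol_nonneg hc hW.one_le_ell
  hΓ0 := by linarith
  hΓ _ _ htn := uvol_le_of_le hmono hβ₀ hc hW.one_le_ell htn
  hj1 := one_le_jvol d _
  hsmall := hsmall_jvol d _
  huS t ht := by
    rw [floorK, if_pos ht]
    exact uvol_mul_le_of_clause hW.expF hE₂ ht (zero_le_one.trans (hW.one_le_ell t ht)) (hlow t ht) (hW.wS t ht)
  huE₂ n hn := uvol_mul_le_of_clause hW.expF hE₂ hn (zero_le_one.trans (hW.one_le_ell n hn)) (hlow n hn) (hW.wE₂ n hn)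
  huE₃ n hn := uvol_mul_le_of_clause hW.expF hE₃ hn (zero_le_one.trans (hW.one_le_ell n hn)) (hlow n hn) (hW.wE₃ n hn)

/-- the same from (2.7) at any exponent `p ≥ 1` and (2.5) itself. [folklore] -/
theorem volumeDisplaysS_uvol_of_isRj (hp : 1 ≤ p) (h27 : B14.FlowIneq27 g β' β₀ p K) (hβ₀ : 0 ≤ β₀) (hc : 0 ≤ cΛ)
    (hE₂ : 0 ≤ C.E₂) (hE₃ : 0 ≤ C.E₃) (hRj : ∀ t, t ≤ K → B14.IsRj L r (g t) (R t))
    (hW : VolumeWindowS C d K r κ₂ κᵥ cΛ θv a g) :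
    VolumeDisplaysS C d K R (uvol cΛ g K) (1 + β₀) (jvol d (1 + β₀)) :=
  volumeDisplaysS_uvol
    (fun _ _ hmn hn => ell_later_le_of_flowIneq27 hp h27 hβ₀ (fun j hj => zero_le_one.trans (hW.one_le_ell j hj)) hmn hn)
    hβ₀ hc hE₂ hE₃ (fun t ht => by obtain ⟨_, _, h, _⟩ := hRj t ht; exact h) hW

/-- **RECORD-FACING FORM PER CUBE** (cost pinned by `hΛ : log (Λ t) = uvol cΛ g K t`). [folklore] -/
theorem volumeDisplaysS_of_log_eq {Λ : ℕ → ℝ} (hΛ : ∀ t, Real.log (Λ t) = uvol cΛ g K t)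
    (hmono : ∀ m n, m < n → n ≤ K → ell g n ≤ (1 + β₀) * ell g m) (hβ₀ : 0 ≤ β₀) (hc : 0 ≤ cΛ) (hE₂ : 0 ≤ C.E₂)
    (hE₃ : 0 ≤ C.E₃) (hlow : ∀ t, t ≤ K → ell g t ^ r ≤ (R t : ℝ))
    (hW : VolumeWindowS C d K r κ₂ κᵥ cΛ θv a g) :
    VolumeDisplaysS C d K R (fun t => Real.log (Λ t)) (1 + β₀) (jvol d (1 + β₀)) := by
  rw [show (fun t => Real.log (Λ t)) = uvol cΛ g K from funext hΛ]; exact volumeDisplaysS_uvol hmono hβ₀ hc hE₂ hE₃ hlow hW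

/-- **`huθS` IN THE OWNER's EVENT SHAPE** for a cost pinned by `hΛ`: over any finite family of events read through `sh`,
`∀ e ∈ E, (sh e).kind = 0 → (sh e).step ≤ K → a * log (Λ (sh e).step) ≤ θᵥ * p₀(g (sh e).step)²` (`a := cvol d j Γ` of record). [folklore] -/
theorem huθS_events_of_log_eq {ε : Type*} {Λ : ℕ → ℝ} (hΛ : ∀ t, Real.log (Λ t) = uvol cΛ g K t)
    (hW : VolumeWindowS C d K r κ₂ κᵥ cΛ θv a g) (sh : ε → PEv) (E : Finset ε) :
    ∀ e ∈ E, (sh e).kind = 0 → (sh e).step ≤ K →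
      a * Real.log (Λ (sh e).step) ≤ θv * p0Profile C.A₀ C.p₀ (g (sh e).step) ^ 2 :=
  fun e _ _ hs => by rw [hΛ]; exact huθS_uvol hW _ hs

/-- **THE PER-CUBE SHRUNK THRESHOLD** `ℓₛ = max{1, (6·1122^d·cΛ∕E₂)^{1∕κ₂}, (15·126^d·cΛ∕E₂)^{1∕κ₂}, (24·126^d·cΛ∕E₃)^{1∕κ₂},
(a·cΛ∕(θᵥA₀²))^{1∕κᵥ}}` (weight `a`, of record `cvol d j Γ`). [folklore] -/
def ellVolS (C : T4PrintedShapeBanking.Consts) (d κ₂ κᵥ : ℕ) (cΛ θv a : ℝ) : ℝ :=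
  max 1 (max (max ((6 * 1122 ^ d * cΛ / C.E₂) ^ ((1 : ℝ) / κ₂)) ((15 * 126 ^ d * cΛ / C.E₂) ^ ((1 : ℝ) / κ₂)))
    (max ((24 * 126 ^ d * cΛ / C.E₃) ^ ((1 : ℝ) / κ₂)) ((a * cΛ / (θv * C.A₀ ^ 2)) ^ ((1 : ℝ) / κᵥ))))

/-- **THE PER-CUBE SHRUNK WINDOW FROM ONE THRESHOLD** (weight `a ≥ 0`). [folklore] -/
theorem volumeWindowS_of_threshold (hexpF : 1 + κ₂ = r * C.q') (hexpV : 1 + κᵥ = 2 * C.p₀) (hκ₂ : 1 ≤ κ₂) (hκᵥ : 1 ≤ κᵥ)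
    (hc : 0 ≤ cΛ) (hE₂ : 0 < C.E₂) (hE₃ : 0 < C.E₃) (hθ : 0 < θv) (hA₀ : C.A₀ ≠ 0) (ha : 0 ≤ a)
    (hwin : ∀ n, n ≤ K → ellVolS C d κ₂ κᵥ cΛ θv a ≤ ell g n) : VolumeWindowS C d K r κ₂ κᵥ cΛ θv a g := by
  have hA2 : 0 < θv * C.A₀ ^ 2 := by positivity
  have hcv : 0 ≤ a * cΛ := mul_nonneg ha hc
  have hle : ∀ n, n ≤ K → 1 ≤ ell g n ∧ (6 * 1122 ^ d * cΛ / C.E₂) ^ ((1 : ℝ) / κ₂) ≤ ell g n ∧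
      (15 * 126 ^ d * cΛ / C.E₂) ^ ((1 : ℝ) / κ₂) ≤ ell g n ∧ (24 * 126 ^ d * cΛ / C.E₃) ^ ((1 : ℝ) / κ₂) ≤ ell g n ∧
      (a * cΛ / (θv * C.A₀ ^ 2)) ^ ((1 : ℝ) / κᵥ) ≤ ell g n := fun n hn => by
    have h := hwin n hn; simp only [ellVolS, max_le_iff] at h; exact ⟨h.1, h.2.1.1, h.2.1.2, h.2.2.1, h.2.2.2⟩
  refine ⟨hexpF, hexpV, fun n hn => (hle n hn).1, fun n hn => ?_, fun n hn => ?_, fun n hn => ?_, fun n hn => ?_⟩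
  · have h := le_pow_of_rpow_inv_le (div_nonneg (by positivity) hE₂.le) hκ₂ (hle n hn).2.1; rw [div_le_iff₀ hE₂] at h; linarith
  · have h := le_pow_of_rpow_inv_le (div_nonneg (by positivity) hE₂.le) hκ₂ (hle n hn).2.2.1; rw [div_le_iff₀ hE₂] at h; linarith
  · have h := le_pow_of_rpow_inv_le (div_nonneg (by positivity) hE₃.le) hκ₂ (hle n hn).2.2.2.1; rw [div_le_iff₀ hE₃] at h; linarith
  · have h := le_pow_of_rpow_inv_le (div_nonneg hcv hA2.le) hκᵥ (hle n hn).2.2.2.2; rw [div_le_iff₀ hA2] at h; linarith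

/-- **… FROM THE COUPLINGS**: `0 < g_n ≤ γ ≤ e^{−ℓₛ∕2}` on the performed range gives the per-cube shrunk window. [folklore] -/
theorem volumeWindowS_of_couplings (hexpF : 1 + κ₂ = r * C.q') (hexpV : 1 + κᵥ = 2 * C.p₀) (hκ₂ : 1 ≤ κ₂) (hκᵥ : 1 ≤ κᵥ)
    (hc : 0 ≤ cΛ) (hE₂ : 0 < C.E₂) (hE₃ : 0 < C.E₃) (hθ : 0 < θv) (hA₀ : C.A₀ ≠ 0) (ha : 0 ≤ a)
    (hγ : γ ≤ Real.exp (-(ellVolS C d κ₂ κᵥ cΛ θv a / 2))) (hg : ∀ n, n ≤ K → 0 < g n ∧ g n ≤ γ) :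
    VolumeWindowS C d K r κ₂ κᵥ cΛ θv a g :=
  volumeWindowS_of_threshold hexpF hexpV hκ₂ hκᵥ hc hE₂ hE₃ hθ hA₀ ha fun n hn => le_ell_of_coupling (hg n hn).1 (hg n hn).2 hγ

/-- the per-cube shrunk threshold's coupling bound is positive. [folklore] -/
theorem exp_neg_ellVolS_pos (C : T4PrintedShapeBanking.Consts) (d κ₂ κᵥ : ℕ) (cΛ θv a : ℝ) :
    0 < Real.exp (-(ellVolS C d κ₂ κᵥ cΛ θv a / 2)) := Real.exp_pos _

/-- **THE OWNER's EIGHT BINDERS FOR A COST PINNED BY `hΛ`, FROM `Flow.InInterval`** (per cube; the filler a record variant D-50-2 with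
`VolumeDisplaysS` fields consumes; fed by `h27`, `isRj`, the prefix at `ellVolS … a`, `a ≥ 0` the slack weight). [folklore] -/
theorem volumeDisplaysS_of_log_eq_of_inInterval (Fl : Flow) (hI : Fl.InInterval γ K) {Λ : ℕ → ℝ}
    (hΛ : ∀ t, Real.log (Λ t) = uvol cΛ Fl.g K t) (hexpF : 1 + κ₂ = r * C.q') (hexpV : 1 + κᵥ = 2 * C.p₀) (hκ₂ : 1 ≤ κ₂)
    (hκᵥ : 1 ≤ κᵥ) (hc : 0 ≤ cΛ) (hE₂ : 0 < C.E₂) (hE₃ : 0 < C.E₃) (hθ : 0 < θv) (hA₀ : C.A₀ ≠ 0) (ha : 0 ≤ a) (hβ₀ : 0 ≤ β₀)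
    (hp : 1 ≤ p) (h27 : B14.FlowIneq27 Fl.g β' β₀ p K) (hRj : ∀ t, t ≤ K → B14.IsRj L r (Fl.g t) (R t))
    (hγ : γ ≤ Real.exp (-(ellVolS C d κ₂ κᵥ cΛ θv a / 2))) :
    VolumeDisplaysS C d K R (fun t => Real.log (Λ t)) (1 + β₀) (jvol d (1 + β₀)) := by
  rw [show (fun t => Real.log (Λ t)) = uvol cΛ Fl.g K from funext hΛ]
  exact volumeDisplaysS_uvol_of_isRj hp h27 hβ₀ hc hE₂.le hE₃.le hRj
    (volumeWindowS_of_couplings hexpF hexpV hκ₂ hκᵥ hc hE₂ hE₃ hθ hA₀ ha hγ fun n hn => hI n hn)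

/-- **`huθS` OVER EVENTS FOR A COST PINNED BY `hΛ`, FROM `Flow.InInterval`** (per cube; weight `a ≥ 0`). [folklore] -/
theorem huθS_events_of_log_eq_of_inInterval (Fl : Flow) (hI : Fl.InInterval γ K) {Λ : ℕ → ℝ}
    (hΛ : ∀ t, Real.log (Λ t) = uvol cΛ Fl.g K t) (hexpF : 1 + κ₂ = r * C.q') (hexpV : 1 + κᵥ = 2 * C.p₀) (hκ₂ : 1 ≤ κ₂)
    (hκᵥ : 1 ≤ κᵥ) (hc : 0 ≤ cΛ) (hE₂ : 0 < C.E₂) (hE₃ : 0 < C.E₃) (hθ : 0 < θv) (hA₀ : C.A₀ ≠ 0) (ha : 0 ≤ a)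
    (hγ : γ ≤ Real.exp (-(ellVolS C d κ₂ κᵥ cΛ θv a / 2))) {ε : Type*} (sh : ε → PEv) (E : Finset ε) :
    ∀ e ∈ E, (sh e).kind = 0 → (sh e).step ≤ K →
      a * Real.log (Λ (sh e).step) ≤ θv * p0Profile C.A₀ C.p₀ (Fl.g (sh e).step) ^ 2 :=
  huθS_events_of_log_eq hΛ (volumeWindowS_of_couplings hexpF hexpV hκ₂ hκᵥ hc hE₂ hE₃ hθ hA₀ ha hγ fun n hn => hI n hn) sh E

end PerCube

/-! ## §3 Lattice units: `u := uvolL cΛ M d g R K`, `Γ := (1+β₀)·L^d`, `j := jvol d ((1+β₀)·L^d)` -/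
section Lattice

/-- **THE SHRUNK WINDOW IN LATTICE UNITS** (HYPOTHESIS SHAPE; gaps `1 + κ₂ = r·(q′ − d)`, `d ≤ q′`, `1 + r·d + κᵥ = 2p₀`; floor-type
clauses at `cΛ·M^d`, the slack clause at a displayed weight `a` (of record `cvol d j Γ`, `Γ := (1+β₀)·L^d`, `j := jvol d Γ`) and letter
`cΛ·(L·M)^d`). [folklore] -/
structure VolumeWindowSL (C : T4PrintedShapeBanking.Consts) (d K r κ₂ κᵥ : ℕ) (cΛ M : ℝ) (L : ℕ) (θv a : ℝ) (g : ℕ → ℝ) :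
    Prop where
  /-- `1 + κ₂ = r·(q′ − d)` -/
  expF : 1 + κ₂ = r * (C.q' - d)
  /-- `d ≤ q′` -/
  hdq : d ≤ C.q'
  /-- `1 + r·d + κᵥ = 2p₀` -/
  expV : 1 + r * d + κᵥ = 2 * C.p₀
  /-- `ℓ ≥ 1` on the performed range -/
  one_le_ell : ∀ n, n ≤ K → 1 ≤ ell g n
  /-- (WS1ᴸ) -/
  wS : ∀ n, n ≤ K → 6 * 1122 ^ d * (cΛ * M ^ d) ≤ C.E₂ * ell g n ^ κ₂
  /-- (WS2ᴸ) -/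
  wE₂ : ∀ n, n ≤ K → 15 * 126 ^ d * (cΛ * M ^ d) ≤ C.E₂ * ell g n ^ κ₂
  /-- (WS3ᴸ) -/
  wE₃ : ∀ n, n ≤ K → 24 * 126 ^ d * (cΛ * M ^ d) ≤ C.E₃ * ell g n ^ κ₂
  /-- (WS4ᴸ), at the weight `a` -/
  wV : ∀ n, n ≤ K → a * (cΛ * (L * M) ^ d) ≤ θv * C.A₀ ^ 2 * ell g n ^ κᵥ

variable {C : T4PrintedShapeBanking.Consts} {d K r κ₂ κᵥ p L : ℕ} {cΛ M θv a β' β'' β₀ β₀'' γ : ℝ} {g : ℕ → ℝ} {R : ℕ → ℕ}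

/-- **`huθS` IN LATTICE UNITS** at the window's weight `a ≥ 0` (upper (2.5) member `R_n ≤ L·ℓ_n^{r}`, `cΛ, M ≥ 0`):
`a·uvolL … n ≤ θᵥ·p₀(g_n)²`, `n ≤ K`. [folklore] -/
theorem huθSL_uvolL (hW : VolumeWindowSL C d K r κ₂ κᵥ cΛ M L θv a g) (hc : 0 ≤ cΛ) (hM : 0 ≤ M) (ha : 0 ≤ a)
    (hup : ∀ n, n ≤ K → (R n : ℝ) ≤ L * ell g n ^ r) (n : ℕ) (hn : n ≤ K) :
    a * uvolL cΛ M d g R K n ≤ θv * p0Profile C.A₀ C.p₀ (g n) ^ 2 := by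
  rw [uvolL_of_le cΛ M d g R hn]
  exact coef_mul_letterL_le_credit hW.expV ha hc hM (zero_le_one.trans (hW.one_le_ell n hn)) (hup n hn) (hW.wV n hn)

/-- **M5-2d's BINDERS DISCHARGED IN LATTICE UNITS**: (2.7)'s and (2.9)'s consequences, `β₀, cΛ, M ≥ 0`, `L ≥ 1`, `E₂, E₃ ≥ 0`, the lower
(2.5) member and the window (any weight) give `VolumeDisplaysS C d K R (uvolL cΛ M d g R K) ((1+β₀)·L^d) (jvol d ((1+β₀)·L^d))`. [folklore] -/
theorem volumeDisplaysSL_uvolL (hmono : ∀ m n, m < n → n ≤ K → ell g n ≤ (1 + β₀) * ell g m)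
    (hRmono : ∀ m n, m < n → n ≤ K → (R n : ℝ) ≤ L * R m) (hβ₀ : 0 ≤ β₀) (hc : 0 ≤ cΛ) (hM : 0 ≤ M) (hL : 1 ≤ L)
    (hE₂ : 0 ≤ C.E₂) (hE₃ : 0 ≤ C.E₃) (hlow : ∀ t, t ≤ K → ell g t ^ r ≤ (R t : ℝ))
    (hW : VolumeWindowSL C d K r κ₂ κᵥ cΛ M L θv a g) :
    VolumeDisplaysS C d K R (uvolL cΛ M d g R K) ((1 + β₀) * L ^ d) (jvol d ((1 + β₀) * L ^ d)) where
  hu := uvolL_nonneg hc hM hW.one_le_ell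
  hΓ0 := by positivity
  hΓ _ _ htn := uvolL_le_of_le hmono hRmono hβ₀ hc hM hL hW.one_le_ell htn
  hj1 := one_le_jvol d _
  hsmall := hsmall_jvol d _
  huS t ht := by
    rw [floorK, if_pos ht]
    exact uvolL_mul_le_of_clause hW.expF hW.hdq hE₂ ht (zero_le_one.trans (hW.one_le_ell t ht)) (hlow t ht) (hW.wS t ht)
  huE₂ n hn := uvolL_mul_le_of_clause hW.expF hW.hdq hE₂ hn (zero_le_one.trans (hW.one_le_ell n hn)) (hlow n hn) (hW.wE₂ n hn)
  huE₃ n hn := uvolL_mul_le_of_clause hW.expF hW.hdq hE₃ hn (zero_le_one.trans (hW.one_le_ell n hn)) (hlow n hn) (hW.wE₃ n hn)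

/-- the same from (2.7) at any exponent `p ≥ 1`, (2.9) and (2.5) itself. [folklore] -/
theorem volumeDisplaysSL_uvolL_of_isRj (hp : 1 ≤ p) (h27 : B14.FlowIneq27 g β' β₀ p K)
    (h29 : B14FlowStep.FlowIneq29 R g L β'' β₀'' K) (hβ₀ : 0 ≤ β₀) (hc : 0 ≤ cΛ) (hM : 0 ≤ M) (hL : 1 ≤ L) (hE₂ : 0 ≤ C.E₂)
    (hE₃ : 0 ≤ C.E₃) (hRj : ∀ t, t ≤ K → B14.IsRj L r (g t) (R t))
    (hW : VolumeWindowSL C d K r κ₂ κᵥ cΛ M L θv a g) :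
    VolumeDisplaysS C d K R (uvolL cΛ M d g R K) ((1 + β₀) * L ^ d) (jvol d ((1 + β₀) * L ^ d)) :=
  volumeDisplaysSL_uvolL
    (fun _ _ hmn hn => ell_later_le_of_flowIneq27 hp h27 hβ₀ (fun j hj => zero_le_one.trans (hW.one_le_ell j hj)) hmn hn)
    (fun _ _ hmn hn => (h29 _ _ hmn hn).1) hβ₀ hc hM hL hE₂ hE₃ (fun t ht => by obtain ⟨_, _, h, _⟩ := hRj t ht; exact h) hW

/-- **RECORD-FACING FORM IN LATTICE UNITS** (cost pinned by `hΛ : log (Λ t) = uvolL cΛ M d g R K t`). [folklore] -/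
theorem volumeDisplaysSL_of_log_eq {Λ : ℕ → ℝ} (hΛ : ∀ t, Real.log (Λ t) = uvolL cΛ M d g R K t)
    (hmono : ∀ m n, m < n → n ≤ K → ell g n ≤ (1 + β₀) * ell g m)
    (hRmono : ∀ m n, m < n → n ≤ K → (R n : ℝ) ≤ L * R m) (hβ₀ : 0 ≤ β₀) (hc : 0 ≤ cΛ) (hM : 0 ≤ M) (hL : 1 ≤ L)
    (hE₂ : 0 ≤ C.E₂) (hE₃ : 0 ≤ C.E₃) (hlow : ∀ t, t ≤ K → ell g t ^ r ≤ (R t : ℝ))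
    (hW : VolumeWindowSL C d K r κ₂ κᵥ cΛ M L θv a g) :
    VolumeDisplaysS C d K R (fun t => Real.log (Λ t)) ((1 + β₀) * L ^ d) (jvol d ((1 + β₀) * L ^ d)) := by
  rw [show (fun t => Real.log (Λ t)) = uvolL cΛ M d g R K from funext hΛ]
  exact volumeDisplaysSL_uvolL hmono hRmono hβ₀ hc hM hL hE₂ hE₃ hlow hW

/-- **`huθS` OVER EVENTS IN LATTICE UNITS** for a cost pinned by `hΛ` (weight `a ≥ 0`; upper (2.5) member `hup`). [folklore] -/
theorem huθSL_events_of_log_eq {ε : Type*} {Λ : ℕ → ℝ} (hΛ : ∀ t, Real.log (Λ t) = uvolL cΛ M d g R K t)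
    (hW : VolumeWindowSL C d K r κ₂ κᵥ cΛ M L θv a g) (hc : 0 ≤ cΛ) (hM : 0 ≤ M) (ha : 0 ≤ a)
    (hup : ∀ n, n ≤ K → (R n : ℝ) ≤ L * ell g n ^ r) (sh : ε → PEv) (E : Finset ε) :
    ∀ e ∈ E, (sh e).kind = 0 → (sh e).step ≤ K →
      a * Real.log (Λ (sh e).step) ≤ θv * p0Profile C.A₀ C.p₀ (g (sh e).step) ^ 2 :=
  fun e _ _ hs => by rw [hΛ]; exact huθSL_uvolL hW hc hM ha hup _ hs

/-- **THE LATTICE SHRUNK THRESHOLD** `ℓₛᴸ = max{1, (6·1122^d·cΛM^d∕E₂)^{1∕κ₂}, (15·126^d·cΛM^d∕E₂)^{1∕κ₂}, (24·126^d·cΛM^d∕E₃)^{1∕κ₂},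
(a·cΛ(LM)^d∕(θᵥA₀²))^{1∕κᵥ}}` (weight `a`, of record `cvol d j Γ`). [folklore] -/
def ellVolSL (C : T4PrintedShapeBanking.Consts) (d κ₂ κᵥ : ℕ) (cΛ M : ℝ) (L : ℕ) (θv a : ℝ) : ℝ :=
  max 1 (max (max ((6 * 1122 ^ d * (cΛ * M ^ d) / C.E₂) ^ ((1 : ℝ) / κ₂)) ((15 * 126 ^ d * (cΛ * M ^ d) / C.E₂) ^ ((1 : ℝ) / κ₂)))
    (max ((24 * 126 ^ d * (cΛ * M ^ d) / C.E₃) ^ ((1 : ℝ) / κ₂))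
      ((a * (cΛ * (L * M) ^ d) / (θv * C.A₀ ^ 2)) ^ ((1 : ℝ) / κᵥ))))

/-- **THE LATTICE SHRUNK WINDOW FROM ONE THRESHOLD** (`cΛ, M, a ≥ 0`, gaps `≥ 1`, signs). [folklore] -/
theorem volumeWindowSL_of_threshold (hexpF : 1 + κ₂ = r * (C.q' - d)) (hdq : d ≤ C.q') (hexpV : 1 + r * d + κᵥ = 2 * C.p₀)
    (hκ₂ : 1 ≤ κ₂) (hκᵥ : 1 ≤ κᵥ) (hc : 0 ≤ cΛ) (hM : 0 ≤ M) (hE₂ : 0 < C.E₂) (hE₃ : 0 < C.E₃) (hθ : 0 < θv) (hA₀ : C.A₀ ≠ 0)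
    (ha : 0 ≤ a) (hwin : ∀ n, n ≤ K → ellVolSL C d κ₂ κᵥ cΛ M L θv a ≤ ell g n) :
    VolumeWindowSL C d K r κ₂ κᵥ cΛ M L θv a g := by
  have hA2 : 0 < θv * C.A₀ ^ 2 := by positivity
  have hcv : 0 ≤ a * (cΛ * (L * M) ^ d) := mul_nonneg ha (mul_nonneg hc (pow_nonneg (mul_nonneg (Nat.cast_nonneg _) hM) _))
  have hle : ∀ n, n ≤ K → 1 ≤ ell g n ∧ (6 * 1122 ^ d * (cΛ * M ^ d) / C.E₂) ^ ((1 : ℝ) / κ₂) ≤ ell g n ∧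
      (15 * 126 ^ d * (cΛ * M ^ d) / C.E₂) ^ ((1 : ℝ) / κ₂) ≤ ell g n ∧ (24 * 126 ^ d * (cΛ * M ^ d) / C.E₃) ^ ((1 : ℝ) / κ₂) ≤ ell g n ∧
      (a * (cΛ * (L * M) ^ d) / (θv * C.A₀ ^ 2)) ^ ((1 : ℝ) / κᵥ) ≤ ell g n := fun n hn => by
    have h := hwin n hn; simp only [ellVolSL, max_le_iff] at h; exact ⟨h.1, h.2.1.1, h.2.1.2, h.2.2.1, h.2.2.2⟩
  refine ⟨hexpF, hdq, hexpV, fun n hn => (hle n hn).1, fun n hn => ?_, fun n hn => ?_, fun n hn => ?_, fun n hn => ?_⟩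
  · have h := le_pow_of_rpow_inv_le (div_nonneg (by positivity) hE₂.le) hκ₂ (hle n hn).2.1; rw [div_le_iff₀ hE₂] at h; linarith
  · have h := le_pow_of_rpow_inv_le (div_nonneg (by positivity) hE₂.le) hκ₂ (hle n hn).2.2.1; rw [div_le_iff₀ hE₂] at h; linarith
  · have h := le_pow_of_rpow_inv_le (div_nonneg (by positivity) hE₃.le) hκ₂ (hle n hn).2.2.2.1; rw [div_le_iff₀ hE₃] at h; linarith
  · have h := le_pow_of_rpow_inv_le (div_nonneg hcv hA2.le) hκᵥ (hle n hn).2.2.2.2; rw [div_le_iff₀ hA2] at h; linarith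

/-- **… FROM THE COUPLINGS** (`0 < g_n ≤ γ ≤ e^{−ℓₛᴸ∕2}` on the performed range). [folklore] -/
theorem volumeWindowSL_of_couplings (hexpF : 1 + κ₂ = r * (C.q' - d)) (hdq : d ≤ C.q') (hexpV : 1 + r * d + κᵥ = 2 * C.p₀)
    (hκ₂ : 1 ≤ κ₂) (hκᵥ : 1 ≤ κᵥ) (hc : 0 ≤ cΛ) (hM : 0 ≤ M) (hE₂ : 0 < C.E₂) (hE₃ : 0 < C.E₃) (hθ : 0 < θv) (hA₀ : C.A₀ ≠ 0)
    (ha : 0 ≤ a) (hγ : γ ≤ Real.exp (-(ellVolSL C d κ₂ κᵥ cΛ M L θv a / 2))) (hg : ∀ n, n ≤ K → 0 < g n ∧ g n ≤ γ) :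
    VolumeWindowSL C d K r κ₂ κᵥ cΛ M L θv a g :=
  volumeWindowSL_of_threshold hexpF hdq hexpV hκ₂ hκᵥ hc hM hE₂ hE₃ hθ hA₀ ha
    fun n hn => le_ell_of_coupling (hg n hn).1 (hg n hn).2 hγ

/-- the lattice shrunk threshold's coupling bound is positive. [folklore] -/
theorem exp_neg_ellVolSL_pos (C : T4PrintedShapeBanking.Consts) (d κ₂ κᵥ : ℕ) (cΛ M : ℝ) (L : ℕ) (θv a : ℝ) :
    0 < Real.exp (-(ellVolSL C d κ₂ κᵥ cΛ M L θv a / 2)) := Real.exp_pos _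

/-- **THE OWNER's EIGHT BINDERS FOR A COST PINNED BY `hΛL`, FROM `Flow.InInterval`** (lattice units; fed by `h27`, `h29`, `isRj`,
the prefix at `ellVolSL … a`, `a ≥ 0` the slack weight). [folklore] -/
theorem volumeDisplaysSL_of_log_eq_of_inInterval (Fl : Flow) (hI : Fl.InInterval γ K) {Λ : ℕ → ℝ}
    (hΛ : ∀ t, Real.log (Λ t) = uvolL cΛ M d Fl.g R K t) (hexpF : 1 + κ₂ = r * (C.q' - d)) (hdq : d ≤ C.q')
    (hexpV : 1 + r * d + κᵥ = 2 * C.p₀) (hκ₂ : 1 ≤ κ₂) (hκᵥ : 1 ≤ κᵥ) (hc : 0 ≤ cΛ) (hM : 0 ≤ M) (hL : 1 ≤ L)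
    (hE₂ : 0 < C.E₂) (hE₃ : 0 < C.E₃) (hθ : 0 < θv) (hA₀ : C.A₀ ≠ 0) (ha : 0 ≤ a) (hβ₀ : 0 ≤ β₀) (hp : 1 ≤ p)
    (h27 : B14.FlowIneq27 Fl.g β' β₀ p K) (h29 : B14FlowStep.FlowIneq29 R Fl.g L β'' β₀'' K)
    (hRj : ∀ t, t ≤ K → B14.IsRj L r (Fl.g t) (R t)) (hγ : γ ≤ Real.exp (-(ellVolSL C d κ₂ κᵥ cΛ M L θv a / 2))) :
    VolumeDisplaysS C d K R (fun t => Real.log (Λ t)) ((1 + β₀) * L ^ d) (jvol d ((1 + β₀) * L ^ d)) := by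
  rw [show (fun t => Real.log (Λ t)) = uvolL cΛ M d Fl.g R K from funext hΛ]
  exact volumeDisplaysSL_uvolL_of_isRj hp h27 h29 hβ₀ hc hM hL hE₂.le hE₃.le hRj
    (volumeWindowSL_of_couplings hexpF hdq hexpV hκ₂ hκᵥ hc hM hE₂ hE₃ hθ hA₀ ha hγ fun n hn => hI n hn)

/-- **`huθS` OVER EVENTS FOR A COST PINNED BY `hΛL`, FROM `Flow.InInterval`** (lattice units; weight `a ≥ 0`; upper (2.5) member from
`isRj`, `L ≥ 1`). [folklore] -/
theorem huθSL_events_of_log_eq_of_inInterval (Fl : Flow) (hI : Fl.InInterval γ K) {Λ : ℕ → ℝ}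
    (hΛ : ∀ t, Real.log (Λ t) = uvolL cΛ M d Fl.g R K t) (hexpF : 1 + κ₂ = r * (C.q' - d)) (hdq : d ≤ C.q')
    (hexpV : 1 + r * d + κᵥ = 2 * C.p₀) (hκ₂ : 1 ≤ κ₂) (hκᵥ : 1 ≤ κᵥ) (hc : 0 ≤ cΛ) (hM : 0 ≤ M) (hL : 1 ≤ L)
    (hE₂ : 0 < C.E₂) (hE₃ : 0 < C.E₃) (hθ : 0 < θv) (hA₀ : C.A₀ ≠ 0) (ha : 0 ≤ a)
    (hRj : ∀ t, t ≤ K → B14.IsRj L r (Fl.g t) (R t)) (hγ : γ ≤ Real.exp (-(ellVolSL C d κ₂ κᵥ cΛ M L θv a / 2)))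
    {ε : Type*} (sh : ε → PEv) (E : Finset ε) :
    ∀ e ∈ E, (sh e).kind = 0 → (sh e).step ≤ K → a * Real.log (Λ (sh e).step) ≤ θv * p0Profile C.A₀ C.p₀ (Fl.g (sh e).step) ^ 2 :=
  have hW := volumeWindowSL_of_couplings hexpF hdq hexpV hκ₂ hκᵥ hc hM hE₂ hE₃ hθ hA₀ ha hγ fun n hn => hI n hn
  huθSL_events_of_log_eq hΛ hW hc hM ha (fun t ht => (envelope_of_isRj hL (hRj t ht) (hW.one_le_ell t ht)).1) sh E

end Lattice

end

end Summit.QuantumFields.BalabanUV.T4Continuum.HistoryBankingVolumeWindowShrunk
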